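import Summits.HodgeConjecture.CorCM.CyclicSexticCMTypes
import Summits.HodgeConjecture.CorCM.QuadraticCMTypeSlice
import Literature.AlgebraicGeometry.ComplexMultiplication.CMTypeGaloisConjugateIsogeny
import HarnessLib

/-!
# COR-CM — over a GALOIS sextic CM field `K ⊇ k`, any two CM types not induced from `k` are Galois twists of each
# other; hence any two simple CM threefolds with CM by `K` are isogenous

Cell `pub-hodgecm2` (COR-CM), seat b30 gen 14 (2026-08-21); COUNT-NEUTRAL; theorems only, no definition, no named fact,
no `sorry`.  Purpose: to REMOVE the hypothesis «`K` not Galois» from the geometric theorems of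
`CorCM/DihedralSexticPairCurveHodgeOfMarkmanSimple.lean` — if `K` is Galois, two non-induced types are twists
`Φ₁ = σⁿΦ₀` (`cmTypeMap`), so their realisations are isogenous (the tree's `isIsogenous_of_cmTypeMap`, Shimura §6.1
Cor.), contradicting «`B₀ ≁ B₁`».

Setting: `K` a CM field, Galois over `ℚ` of degree `6` — so `Gal(K/ℚ) = ⟨σ⟩ ≅ C₆` with `σ³ = ρ`
(`CyclicSextic.exists_generator`) and `Hom(K, ℂ) = {p ∘ σⁿ}` (`CyclicSextic.emb`) — and `i : k →+* K` an embedding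
of an imaginary quadratic field.

* §1 `sq_comp_eq` — **`σ² ∘ i = i`**: `p ∘ σ² ∘ i ∈ {p ∘ i, (p ∘ i)‾ = p ∘ σ³ ∘ i}` (`Hom(k, ℂ) = {t, t̄}`), and in
  either case `σ²` fixes `i(k)` (`σ⁶ = 1`); `emb_comp_eq_emb_mod_two_comp` — the restriction of `p ∘ σⁿ` along `i`
  depends only on `n mod 2`; `emb_one_comp_ne` — and the two restrictions differ (`p ∘ σ ∘ i = p ∘ i` would force
  `p ∘ σ³ ∘ i = p ∘ i`, i.e. `t̄ = t`).
* §2 `exists_mkType_eq_shiftB` (kernel, `decide`): two antipodal vectors `Fin 6 → Bool` each `true` at an even AND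
  an odd index differ by a shift — the six such vectors are the arcs `{a, a+1, a+2}`.
* §3 **`exists_eq_cmTypeMap_pow`**: two CM types of `K` each containing members with different restrictions along
  `i` (not induced from `k`) satisfy `Φ₁ = cmTypeMap (σⁿ) Φ₀`; **`isIsogenous_of_isGalois`**: realisations
  `A_j ⊨ (K; Φ_j)` of two such types are isogenous. [cite: Shimura1998, §6.1 Corollary of Theorem 2, §8.4]
  [cite: Dodson1984, §5.1.2]

## References
* [Shimura1998] G. Shimura, *Abelian Varieties with CM and Modular Functions* (1998), §6.1 Cor., §8.2, §8.4.
* [Dodson1984] B. Dodson, *The structure of Galois groups of CM-fields*, Trans. AMS 283 (1984), §1.1, §5.1.2.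
-/

noncomputable section

open NumberField NumberField.ComplexEmbedding

namespace Summit.HodgeConjecture.CorCM.CyclicSextic

open Literature.AlgebraicGeometry Literature.AlgebraicGeometry.Motives Literature.AlgebraicGeometry.HodgeTheory
open Literature.AlgebraicGeometry.ComplexMultiplication
open Literature.NumberTheory.ComplexMultiplication (conjGal)
open Literature.NumberTheory.Automorphic.PicardCM.CMCode (cmTypeMap)

variable {K : Type} [Field K] [NumberField K] [IsCMField K] {k : Type} [Field k] [NumberField k] [IsCMField k]

/-! ## §1 `σ²` fixes the quadratic subfield -/

section SigmaSq

variable {σ : K ≃ₐ[ℚ] K}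

omit [NumberField k] [IsCMField k] in
/-- `conj (p ∘ σⁿ ∘ i) = p ∘ σⁿ⁺³ ∘ i` (`σ³ = ρ`). [folklore] -/
theorem conjugate_emb_comp (h3 : σ ^ 3 = conjGal) (i : k →+* K) (p : K →+* ℂ) (n : ℕ) :
    conjugate ((emb σ p n).comp i) = (emb σ p (n + 3)).comp i := by
  rw [← conjugate_emb σ p h3 n]
  exact RingHom.ext fun x => by simp only [RingHom.coe_comp, Function.comp_apply, conjugate_coe_eq]

/-- **`σ² ∘ i = i`**: an element of order dividing `3` of `Gal(K/ℚ)` fixes the image of the imaginary quadratic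
field `k` — read through `p`: `p ∘ σ² ∘ i` is `p ∘ i` or its conjugate `p ∘ σ³ ∘ i`, and `σ⁶ = 1`. [folklore] -/
theorem sq_comp_eq (hσ : orderOf σ = 6) (h3 : σ ^ 3 = conjGal) (h2 : Module.finrank ℚ k = 2) (i : k →+* K)
    (p : K →+* ℂ) : (σ ^ 2).toRingEquiv.toRingHom.comp i = i := by
  have h6' : σ ^ 6 = 1 := by rw [← hσ]; exact pow_orderOf_eq_one σ
  have hu : (emb σ p 2).comp i = p.comp i ∨ (emb σ p 2).comp i = conjugate (p.comp i) :=
    QuarticCM.eq_or_eq_conjugate_of_quadratic h2 (p.comp i) _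
  refine RingHom.ext fun x => ?_
  change (σ ^ 2) (i x) = i x
  rcases hu with hu | hu
  · have hx := RingHom.congr_fun hu x
    simp only [RingHom.coe_comp, Function.comp_apply, emb_apply] at hx
    exact p.injective hx
  · -- `p (σ² (i x)) = p (σ³ (i x))`, so `σ` fixes `y = σ² (i x)`; then `y = σ⁴ y = σ⁶ (i x) = i x`
    have hc : conjugate (p.comp i) = (emb σ p 3).comp i := by
      have := conjugate_emb_comp h3 i p 0
      rw [emb_zero] at this
      exact this
    rw [hc] at hu
    have hx := RingHom.congr_fun hu x
    simp only [RingHom.coe_comp, Function.comp_apply, emb_apply] at hx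
    replace hx : (σ ^ 2) (i x) = (σ ^ 3) (i x) := p.injective hx
    have hy : σ ((σ ^ 2) (i x)) = (σ ^ 2) (i x) := by
      rw [pow_succ', AlgEquiv.mul_apply] at hx
      exact hx.symm
    have hfix : ∀ n : ℕ, (σ ^ n) ((σ ^ 2) (i x)) = (σ ^ 2) (i x) := by
      intro n
      induction n with
      | zero => simp
      | succ n ih => rw [pow_succ', AlgEquiv.mul_apply, ih, hy]
    have h42 : σ ^ 4 * σ ^ 2 = 1 := by rw [← pow_add]; exact h6'
    calc (σ ^ 2) (i x) = (σ ^ 4) ((σ ^ 2) (i x)) := (hfix 4).symm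
      _ = i x := by rw [← AlgEquiv.mul_apply, h42, AlgEquiv.one_apply]

/-- The restriction of `p ∘ σⁿ⁺²` along `i` is that of `p ∘ σⁿ`. [folklore] -/
theorem emb_add_two_comp (hσ : orderOf σ = 6) (h3 : σ ^ 3 = conjGal) (h2 : Module.finrank ℚ k = 2)
    (i : k →+* K) (p : K →+* ℂ) (n : ℕ) : (emb σ p (n + 2)).comp i = (emb σ p n).comp i := by
  rw [← emb_comp_pow σ p n 2, RingHom.comp_assoc, sq_comp_eq hσ h3 h2 i p]

/-- **The restriction of `p ∘ σⁿ` along `i` depends only on the parity of `n`.** [folklore] -/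
theorem emb_comp_eq_emb_mod_two_comp (hσ : orderOf σ = 6) (h3 : σ ^ 3 = conjGal)
    (h2 : Module.finrank ℚ k = 2) (i : k →+* K) (p : K →+* ℂ) (n : ℕ) :
    (emb σ p n).comp i = (emb σ p (n % 2)).comp i := by
  have key : ∀ q r : ℕ, (emb σ p (r + 2 * q)).comp i = (emb σ p r).comp i := by
    intro q
    induction q with
    | zero => intro r; simp
    | succ q ih =>
      intro r
      rw [show r + 2 * (q + 1) = (r + 2 * q) + 2 by ring, emb_add_two_comp hσ h3 h2 i p, ih]
  conv_lhs => rw [← Nat.mod_add_div n 2]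
  exact key (n / 2) (n % 2)

/-- **The two restrictions differ**: `p ∘ σ ∘ i ≠ p ∘ i` (else `σ`, hence `σ³ = ρ`, fixes `i(k)`, and `p ∘ i`
would be real). [folklore] -/
theorem emb_one_comp_ne (h3 : σ ^ 3 = conjGal) (i : k →+* K) (p : K →+* ℂ) :
    (emb σ p 1).comp i ≠ (emb σ p 0).comp i := by
  intro h
  have h1 : ∀ x, σ (i x) = i x := fun x => by
    have hx := RingHom.congr_fun h x
    simp only [RingHom.coe_comp, Function.comp_apply, emb_apply, pow_one, pow_zero, AlgEquiv.one_apply] at hx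
    exact p.injective hx
  have h3x : ∀ x, (σ ^ 3) (i x) = i x := fun x => by
    rw [pow_succ', AlgEquiv.mul_apply, pow_two, AlgEquiv.mul_apply, h1, h1, h1]
  apply QuarticCM.conjugate_ne ((emb σ p 0).comp i)
  rw [conjugate_emb_comp h3 i p 0]
  exact RingHom.ext fun x => by simp [h3x]

end SigmaSq

/-! ## §2 Antipodal vectors meeting both parities are shifts of one another (kernel) -/

/-- **The arcs of `ℤ/6`.**  Two antipodal vectors `mkType x y z = (x, y, z, ¬x, ¬y, ¬z)`, each `true` at indices of
both parities, differ by a shift (`shiftB`): such vectors are exactly the six arcs `{a, a+1, a+2}`. [folklore] -/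
theorem exists_mkType_eq_shiftB : ∀ x y z x' y' z' : Bool,
    (∃ a b : Fin 6, mkType x y z a = true ∧ mkType x y z b = true ∧ a.val % 2 ≠ b.val % 2) →
    (∃ a b : Fin 6, mkType x' y' z' a = true ∧ mkType x' y' z' b = true ∧ a.val % 2 ≠ b.val % 2) →
    ∃ k : Fin 6, mkType x' y' z' = shiftB k (mkType x y z) := by
  decide

/-! ## §3 Non-induced types are twists; their realisations are isogenous -/

section Twist

variable [IsGalois ℚ K]

/-- **Two CM types of a Galois sextic CM field `K ⊇ i(k)`, each with two members of different restriction along `i`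
(not induced from `k`), are Galois twists of each other**: `Φ₁ = σⁿΦ₀` for the generator `σ` (`σ³ = ρ`).  In the
coordinates `p ∘ σᵃ` the restriction along `i` is the parity of `a` (§1), so both indicator vectors are arcs (§2).
[cite: Shimura1998, §8.4] [cite: Dodson1984, §5.1.2] -/
theorem exists_eq_cmTypeMap_pow (h6 : Module.finrank ℚ K = 6) {σ : K ≃ₐ[ℚ] K} (hσ : orderOf σ = 6)
    (h3 : σ ^ 3 = conjGal) (h2 : Module.finrank ℚ k = 2) (i : k →+* K) {Φ₀ Φ₁ : CMType K}
    (hprim₀ : ∃ s ∈ Φ₀.1, ∃ s' ∈ Φ₀.1, s.comp i ≠ s'.comp i)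
    (hprim₁ : ∃ s ∈ Φ₁.1, ∃ s' ∈ Φ₁.1, s.comp i ≠ s'.comp i) :
    ∃ n : Fin 6, Φ₁ = cmTypeMap (σ ^ (n : ℕ)).toRingEquiv Φ₀ := by
  obtain ⟨p⟩ : Nonempty (K →+* ℂ) := inferInstance
  -- in coordinates: members of both parities
  have harc : ∀ Φ : CMType K, (∃ s ∈ Φ.1, ∃ s' ∈ Φ.1, s.comp i ≠ s'.comp i) →
      ∃ a b : Fin 6, ind6 σ p Φ a = true ∧ ind6 σ p Φ b = true ∧ a.val % 2 ≠ b.val % 2 := by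
    rintro Φ ⟨s, hs, s', hs', hne⟩
    obtain ⟨a, rfl⟩ := exists_emb_eq σ p h6 hσ s
    obtain ⟨b, rfl⟩ := exists_emb_eq σ p h6 hσ s'
    refine ⟨a, b, (ind6_eq_true_iff σ p Φ a).2 hs, (ind6_eq_true_iff σ p Φ b).2 hs', fun hab => hne ?_⟩
    rw [emb_comp_eq_emb_mod_two_comp hσ h3 h2 i p a, emb_comp_eq_emb_mod_two_comp hσ h3 h2 i p b, hab]
  have e₀ := eq_mkType_of_antipodal (ind6 σ p Φ₀) (ind6_antipodal σ p hσ h3 Φ₀)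
  have e₁ := eq_mkType_of_antipodal (ind6 σ p Φ₁) (ind6_antipodal σ p hσ h3 Φ₁)
  have a₀ := harc Φ₀ hprim₀
  have a₁ := harc Φ₁ hprim₁
  rw [e₀] at a₀
  rw [e₁] at a₁
  obtain ⟨n, hn⟩ := exists_mkType_eq_shiftB _ _ _ _ _ _ a₀ a₁
  rw [← e₀, ← e₁] at hn
  refine ⟨n, eq_of_ind6_eq σ p h6 hσ ?_⟩
  rw [ind6_cmTypeMap σ p hσ]
  exact hn

/-- **Over a Galois sextic CM field, realisations of two non-induced types are isogenous** (`A_Φ ∼ A_{σⁿΦ}`,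
Shimura §6.1 Corollary, tree `isIsogenous_of_cmTypeMap`).  In particular two SIMPLE CM threefolds with CM by the
same Galois (cyclic) sextic CM field are isogenous. [cite: Shimura1998, §6.1 Corollary of Theorem 2, §8.4] -/
theorem isIsogenous_of_isGalois (h6 : Module.finrank ℚ K = 6) (h2 : Module.finrank ℚ k = 2) (i : k →+* K)
    {Φ₀ Φ₁ : CMType K}
    {A₀ : AbelianVariety ℂ} {ι₀ : 𝓞 K →+* CategoryTheory.End A₀}
    {θ₀ : K →+* Module.End ℂ (complexBetti A₀.X 1)}
    {A₁ : AbelianVariety ℂ} {ι₁ : 𝓞 K →+* CategoryTheory.End A₁}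
    {θ₁ : K →+* Module.End ℂ (complexBetti A₁.X 1)}
    (hA₀ : IsCMTypeRealisation Φ₀ A₀ ι₀ θ₀) (hA₁ : IsCMTypeRealisation Φ₁ A₁ ι₁ θ₁)
    (hprim₀ : ∃ s ∈ Φ₀.1, ∃ s' ∈ Φ₀.1, s.comp i ≠ s'.comp i)
    (hprim₁ : ∃ s ∈ Φ₁.1, ∃ s' ∈ Φ₁.1, s.comp i ≠ s'.comp i) :
    AbelianVariety.IsIsogenous A₀ A₁ := by
  obtain ⟨σ, hσ, h3⟩ := exists_generator (K := K) h6
  obtain ⟨n, hn⟩ := exists_eq_cmTypeMap_pow h6 hσ h3 h2 i hprim₀ hprim₁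
  subst hn
  exact isIsogenous_of_cmTypeMap (σ ^ (n : ℕ)).toRingEquiv hA₀ hA₁

end Twist

end Summit.HodgeConjecture.CorCM.CyclicSextic

end
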